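import Literature.Analysis.FluidPDE.NashGeometricLemma
import Literature.Analysis.FluidPDE.TransversePeriodization
import Literature.Analysis.FluidPDE.TransversePullback
import HarnessLib

/-!
# Concentrated Mikado profiles on `𝕋^d` for the directions of the geometric lemma

Fourth file of the Mikado-flow construction for the convex-integration step of
A. Cheskidov, X. Luo, *Sharp nonuniqueness for the Navier–Stokes equations*, Invent. Math. 229
(2022) = arXiv:2009.06596, §4.1 (4.5)–(4.7) and Thm. 4.3 ("stationary Mikado flows
`W_k = ψ_k e_k`", `Δφ_k = ψ_k`, `∫ψ_k² = 1`, `μ^{-m}‖∇^m W_k‖_p ≲ μ^{(d-1)/2-(d-1)/p}`). For every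
direction `x : NashGeometric.Index d` (`k_x = e_i`, `e_i + 2e_j`, `e_i - 2e_j`, the directions of
the proved geometric lemma `NashGeometric.geometric_lemma`) this file supplies the integer
transverse data (`TransverseDatum`, `TransversePullback`) and pulls the periodic transverse
profiles of `TransversePeriodization` back to `𝕋^d`:

* data: `Mikado.axisDatum i` (forms `y_l`, `l ≠ i`), `Mikado.pairDatum i j s` (forms `2yᵢ + s yⱼ`,
  `y_l`; weights `5, 1, …, 1`; direction `eᵢ - 2s eⱼ`, `s = ∓1`), with the finite-sum identities
  (orthogonal rows, annihilation of the direction, integer section) proved by hand;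
  `Mikado.datum x : TransverseDatum d (Slot x)` with `(datum x).k = dir x` (`datum_k`), positive
  weights, `card (Slot x) = d - 1`;
* generic calculus/norms of pulled-back concentrated profiles `conc κ₀ a μ f₀ ∘ L`: smoothness,
  `∂ₗ(conc ∘ L) = ∑ A l l' conc(a+1)(∂_{l'}f₀) ∘ L` (`partialDeriv_pull_conc`), sup bound
  `|κ₀| μ^a sup|f₀|`, and the EXACT scalings `∫_{𝕋^d}|conc ∘ L|^p = |κ₀|^p μ^{ap-(d-1)} ∫_{ℝ^{d-1}}|f₀|^p`
  (`integral_abs_pull_conc_rpow`, CL22 Thm. 4.3 (2)), `∫ (conc∘L)²`, `∫ conc∘L`;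
* the profiles `Mikado.psi x μ`, `Mikado.phi x μ`, `Mikado.theta x μ` on `𝕋^d` (`μ ≥ 1`): smooth,
  **`Δφ = ψ`**, **`ΔΘ = φ`** (`laplacian_phi`, `laplacian_theta`), **invariance along `k_x`**
  (`fderiv_psi_dirVec` etc.: `Dψ(y)k_x = 0`), **unit energy** `∫_{𝕋^d} ψ² = 1` (`integral_psi_sq`,
  `d ≥ 2`), zero means of `ψ`, `φ`.

The vector fields `W_x = ψ_x k̂_x`, `Ω_x = k̂_x ⊗ ∇φ_x - ∇φ_x ⊗ k̂_x` and the identities `div W = 0`,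
`div(W ⊗ W) = 0`, `div Ω = W` of Thm. 4.3 (1) are one-line consequences of the invariance and of
`Δφ = ψ`, taken in the perturbation file with the tensor vocabulary of `EulerReynolds`.
Everything here is proved; no named facts. Part of the decomposition of
`Torus.CheskidovLuo2022ConvexIntegration` (CL22 Prop. 4.1).

## References

* A. Cheskidov, X. Luo, Invent. Math. 229 (2022) = arXiv:2009.06596, §4.1 (4.5)–(4.7), Thm. 4.3.
  [`CheskidovLuo2022`]
-/

noncomputable section

open Set Filter Topology Function MeasureTheory Finset

namespace Literature.Analysis.FluidPDE

namespace Mikado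

open FunctionSpaces FunctionSpaces.Torus NashGeometric Transverse

variable {d : Type*} [Fintype d] [DecidableEq d]

/-! ### Finite-sum identities for the transverse data -/

/-- `∑ₗ [l = a] f l · [l = b] g l = [a = b] f a g a`. [folklore] -/
theorem sum_ite_eq_mul_ite_eq (a b : d) (f g : d → ℝ) :
    ∑ l, (if l = a then f l else 0) * (if l = b then g l else 0) = if a = b then f a * g a else 0 := by
  rw [Finset.sum_eq_single a]
  · by_cases h : a = b
    · subst h; simp
    · simp [h]
  · intro l _ hl; simp [hl]
  · simp

/-- Axis datum: the coordinate forms `y_l`, `l ≠ i`, have orthonormal rows. [folklore] -/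
theorem axis_orth (i : d) (l' l'' : {l : d // l ≠ i}) :
    ∑ l, (if l = l'.1 then (1 : ℝ) else 0) * (if l = l''.1 then (1 : ℝ) else 0) = if l' = l'' then 1 else 0 := by
  rw [sum_ite_eq_mul_ite_eq]
  simp [Subtype.ext_iff]

/-- Axis datum: `Aᵀ A = 1` over `ℤ`. [folklore] -/
theorem axis_orth_int (i : d) (l' l'' : {l : d // l ≠ i}) :
    ∑ l, (if l = l'.1 then (1 : ℤ) else 0) * (if l = l''.1 then (1 : ℤ) else 0) = if l' = l'' then 1 else 0 := by
  rw [Finset.sum_eq_single l'.1]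
  · by_cases h : l' = l''
    · subst h; simp
    · have : l'.1 ≠ l''.1 := fun h' => h (Subtype.ext h')
      simp [this, h]
  · intro l _ hl; simp [hl]
  · simp

/-- Axis datum: the forms `y_l`, `l ≠ i`, annihilate `e_i`. [folklore] -/
theorem axis_annih (i : d) (l' : {l : d // l ≠ i}) :
    ∑ l, (if l = l'.1 then (1 : ℤ) else 0) * (Pi.single i (1 : ℤ) : d → ℤ) l = 0 := by
  rw [Finset.sum_eq_single l'.1]
  · simp [l'.2]
  · intro l _ hl; simp [hl]
  · simp


/-! ### Pair case -/

section Pair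
variable (i j : d) (hij : i ≠ j) (s : ℤ)

/-- Pair datum: the forms `2yᵢ + s yⱼ` (slot `i`) and `y_l` (`l ∉ {i, j}`), indexed by `l ≠ j`. [folklore] -/
def pairA (l : d) (l' : {l : d // l ≠ j}) : ℤ :=
  if l'.1 = i then (if l = i then 2 else if l = j then s else 0) else (if l = l'.1 then 1 else 0)

/-- Pair datum: the integer section `yⱼ = s zᵢ`, `yᵢ = 0`, `y_l = z_l`. [folklore] -/
def pairB (l' : {l : d // l ≠ j}) (l : d) : ℤ :=
  if l'.1 = i then (if l = j then s else 0) else (if l = l'.1 then 1 else 0)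

/-- Pair datum: the weights `5` (slot `i`) and `1`. [folklore] -/
def pairC (l' : {l : d // l ≠ j}) : ℝ := if l'.1 = i then 5 else 1

/-- Pair datum: the direction `eᵢ - 2s eⱼ` (`= eᵢ ± 2eⱼ` for `s = ∓1`). [folklore] -/
def pairK : d → ℤ := Pi.single i 1 - (2 * s) • Pi.single j 1

include hij

omit [Fintype d] in
/-- The `i`-slot form as `2[l = i] + s[l = j]` (real coefficients). [folklore] -/
theorem pairA_islot {l' : {l : d // l ≠ j}} (h : l'.1 = i) (l : d) :
    (pairA i j s l l' : ℝ) = 2 * (if l = i then 1 else 0) + s * (if l = j then 1 else 0) := by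
  simp only [pairA, h, if_true]
  by_cases h1 : l = i
  · subst h1; simp [hij]
  · by_cases h2 : l = j
    · subst h2; simp [h1]
    · simp [h1, h2]

omit [Fintype d] hij in
/-- The other forms are coordinate forms. [folklore] -/
theorem pairA_oslot {l' : {l : d // l ≠ j}} (h : l'.1 ≠ i) (l : d) :
    (pairA i j s l l' : ℝ) = if l = l'.1 then 1 else 0 := by
  simp only [pairA, h, if_false]; split_ifs <;> simp

/-- Pair datum: orthogonal rows with squared lengths `5, 1, …, 1` (`s² = 1`). [folklore] -/
theorem pair_orth (hs : s * s = 1) (l' l'' : {l : d // l ≠ j}) :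
    ∑ l, (pairA i j s l l' : ℝ) * (pairA i j s l l'' : ℝ) = if l' = l'' then pairC i j l' else 0 := by
  have hs' : (s : ℝ) * s = 1 := by exact_mod_cast hs
  by_cases h' : l'.1 = i <;> by_cases h'' : l''.1 = i
  · -- both are the `i`-slot: `l' = l''`, value `4 + s² = 5`
    have heq : l' = l'' := Subtype.ext (h'.trans h''.symm)
    subst heq
    simp only [if_true, pairC, h', pairA]
    rw [Finset.sum_eq_add_of_mem i j (Finset.mem_univ i) (Finset.mem_univ j) hij]
    · simp only [if_true, Ne.symm hij, if_false]
      push_cast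
      linarith
    · intro l _ hl
      simp [hl.1, hl.2]
  · have hne : l' ≠ l'' := fun h => h'' (h ▸ h')
    simp only [hne, if_false, pairA, h', h'', if_true]
    rw [Finset.sum_eq_single l''.1]
    · have h1 : l''.1 ≠ i := h''
      have h2 : l''.1 ≠ j := l''.2
      simp [h1, h2]
    · intro l _ hl; simp [hl]
    · simp
  · have hne : l' ≠ l'' := fun h => h' (h ▸ h'')
    simp only [hne, if_false, pairA, h', h'', if_true]
    rw [Finset.sum_eq_single l'.1]
    · have h1 : l'.1 ≠ i := h'
      have h2 : l'.1 ≠ j := l'.2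
      simp [h1, h2]
    · intro l _ hl; simp [hl]
    · simp
  · simp only [pairA, h', h'', if_false, pairC]
    push_cast
    rw [sum_ite_eq_mul_ite_eq]
    simp [Subtype.ext_iff]

/-- Pair datum: the forms annihilate `eᵢ - 2s eⱼ` (`2·1 + s·(-2s) = 0`). [folklore] -/
theorem pair_annih (hs : s * s = 1) (l' : {l : d // l ≠ j}) : ∑ l, pairA i j s l l' * pairK i j s l = 0 := by
  by_cases h' : l'.1 = i
  · have hcast : ∀ l, (pairA i j s l l' : ℤ) = 2 * (if l = i then 1 else 0) + s * (if l = j then 1 else 0) := by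
      intro l; have := pairA_islot i j hij s h' l; exact_mod_cast this
    simp only [hcast, pairK, Pi.sub_apply, Pi.smul_apply, Pi.single_apply, smul_eq_mul]
    rw [Finset.sum_eq_add_of_mem i j (Finset.mem_univ i) (Finset.mem_univ j) hij]
    · simp [hij, Ne.symm hij]; ring_nf; rw [sq, hs]; ring
    · intro l _ hl; simp [hl.1, hl.2]
  · have hcast : ∀ l, (pairA i j s l l' : ℤ) = if l = l'.1 then 1 else 0 := by
      intro l; have := pairA_oslot i j s h' l; exact_mod_cast this
    simp only [hcast]
    rw [Finset.sum_eq_single l'.1]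
    · have h1 : l'.1 ≠ i := h'
      have h2 : l'.1 ≠ j := l'.2
      simp [pairK, h1, h2]
    · intro l _ hl; simp [hl]
    · simp

/-- Pair datum: `B A = 1`. [folklore] -/
theorem pair_rightInv (hs : s * s = 1) (l' l'' : {l : d // l ≠ j}) :
    ∑ l, pairB i j s l' l * pairA i j s l l'' = if l' = l'' then 1 else 0 := by
  by_cases h' : l'.1 = i
  · -- B row: s at l = j
    simp only [pairB, h', if_true]
    rw [Finset.sum_eq_single j]
    · simp only [if_true]
      by_cases h'' : l''.1 = i
      · have heq : l' = l'' := Subtype.ext (h'.trans h''.symm)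
        simp [pairA, h'', Ne.symm hij, heq, hs]
      · have hne : l' ≠ l'' := fun h => h'' (h ▸ h')
        have h2 : j ≠ l''.1 := fun h => l''.2 h.symm
        simp [pairA, h'', hne, h2]
    · intro l _ hl; simp [hl]
    · simp
  · simp only [pairB, h', if_false]
    rw [Finset.sum_eq_single l'.1]
    · simp only [if_true, one_mul]
      by_cases h'' : l''.1 = i
      · have hne : l' ≠ l'' := fun h => h' (h ▸ h'')
        have h1 : l'.1 ≠ i := h'
        have h2 : l'.1 ≠ j := l'.2
        simp [pairA, h'', h1, h2, hne]
      · simp [pairA, h'', Subtype.ext_iff]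
    · intro l _ hl; simp [hl]
    · simp

end Pair



/-! ## The transverse data of the directions `e_i`, `e_i ± 2e_j` -/

/-- Transverse datum of the axis direction `e_i`: forms `y_l`, `l ≠ i`, unit weights, section `Aᵀ`. [folklore] -/
def axisDatum (i : d) : TransverseDatum d {l : d // l ≠ i} where
  A l l' := if l = l'.1 then 1 else 0
  c _ := 1
  k := Pi.single i 1
  B l' l := if l = l'.1 then 1 else 0
  orth l' l'' := by push_cast; rw [axis_orth i l' l'']
  annih l' := axis_annih i l'
  rightInv l' l'' := axis_orth_int i l' l''

/-- Transverse datum of the pair direction `e_i - 2s e_j` (`s = ∓1`): forms `2y_i + s y_j` (slot `i`)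
and `y_l` (`l ∉ {i, j}`), weights `5, 1, …, 1`, section `y_j = s z_i`, `y_l = z_l`. [folklore] -/
def pairDatum (i j : d) (hij : i ≠ j) (s : ℤ) (hs : s * s = 1) : TransverseDatum d {l : d // l ≠ j} where
  A := pairA i j s
  c := pairC i j
  k := pairK i j s
  B := pairB i j s
  orth := pair_orth i j hij s hs
  annih := pair_annih i j hij s hs
  rightInv := pair_rightInv i j hij s hs

/-- The dropped coordinate: `i` for `e_i`, `j` for `e_i ± 2e_j`. [folklore] -/
def pivot : Index d → d := Sum.elim id (Sum.elim (fun p => p.1.2) (fun p => p.1.2))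

/-- The transverse index type of a direction: all coordinates but the pivot. [folklore] -/
abbrev Slot (x : Index d) : Type _ := {l : d // l ≠ pivot x}

/-- The transverse datum of each direction of the geometric lemma. [folklore] -/
def datum : (x : Index d) → TransverseDatum d (Slot x)
  | Sum.inl i => axisDatum i
  | Sum.inr (Sum.inl p) => pairDatum p.1.1 p.1.2 p.2 (-1) (by norm_num)
  | Sum.inr (Sum.inr p) => pairDatum p.1.1 p.1.2 p.2 1 (by norm_num)

/-- The datum's direction is `NashGeometric.dir`. [folklore] -/
theorem datum_k (x : Index d) : (datum x).k = dir x := by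
  rcases x with i | p | p
  · rfl
  · funext q
    show pairK p.1.1 p.1.2 (-1) q = _
    rw [dir_apply]
    simp [pairK, Pi.single_apply]
  · funext q
    show pairK p.1.1 p.1.2 1 q = _
    rw [dir_apply]
    simp [pairK, Pi.single_apply]


/-- The weights are `1` or `5`, in particular positive. [folklore] -/
theorem datum_c_pos (x : Index d) (l' : Slot x) : 0 < (datum x).c l' := by
  rcases x with i | p | p
  · show (0 : ℝ) < 1; norm_num
  · show (0 : ℝ) < pairC p.1.1 p.1.2 l'
    unfold pairC; split_ifs <;> norm_num
  · show (0 : ℝ) < pairC p.1.1 p.1.2 l'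
    unfold pairC; split_ifs <;> norm_num

/-- `card (Slot x) = card d - 1`. [folklore] -/
theorem card_slot (x : Index d) : Fintype.card (Slot x) = Fintype.card d - 1 := by
  classical
  simp [Slot]

/-- In dimension `≥ 2` the transverse index type is nonempty. [folklore] -/
theorem nonempty_slot (hd : 2 ≤ Fintype.card d) (x : Index d) : Nonempty (Slot x) := by
  classical
  rw [← Fintype.card_pos_iff, card_slot]
  omega

/-! ## Pulled-back concentrated profiles: generic calculus and norms -/

section PullConc

variable {m : Type*} [Fintype m] [DecidableEq m] (T : TransverseDatum d m)
variable {f₀ : EuclideanSpace ℝ m → ℝ} {κ₀ a μ : ℝ}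

omit [DecidableEq d] in
/-- Pulled-back concentrated profiles are smooth on `𝕋^d` (`μ ≥ 1`). [folklore] -/
theorem isSmooth_pull_conc (hf : IsProfile f₀) (hμ : 1 ≤ μ) (κ₀ a : ℝ) :
    IsSmooth (T.pull (conc κ₀ a μ f₀)) :=
  T.isSmooth_pull (isSmooth_conc hf hμ κ₀ a)

/-- **Derivatives of pulled-back profiles**:
`∂ₗ (conc κ₀ a μ f₀ ∘ L) = ∑_{l'} A l l' · (conc κ₀ (a+1) μ (∂_{l'} f₀)) ∘ L`. [folklore] -/
theorem partialDeriv_pull_conc (hf : IsProfile f₀) (hμ : 1 ≤ μ) (κ₀ a : ℝ) (l : d) :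
    partialDeriv l (T.pull (conc κ₀ a μ f₀)) =
      fun y => ∑ l', (T.A l l' : ℝ) * T.pull (conc κ₀ (a + 1) μ (pd l' f₀)) y := by
  funext y
  rw [T.partialDeriv_pull ((isSmooth_conc hf hμ κ₀ a).isContDiff (by simp)) l y]
  refine Finset.sum_congr rfl fun l' _ => ?_
  rw [partialDeriv_conc hf hμ κ₀ a l', smul_eq_mul]
  rfl

omit [DecidableEq d] in
/-- Sup bound for pulled-back profiles: `|conc ∘ L| ≤ |κ₀| μ^a sup|f₀|`. [folklore] -/
theorem abs_pull_conc_le (hf : IsProfile f₀) (hμ : 1 ≤ μ) {B : ℝ} (hB : ∀ z, |f₀ z| ≤ B) (κ₀ a : ℝ)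
    (y : UnitAddTorus d) : |T.pull (conc κ₀ a μ f₀) y| ≤ |κ₀| * μ ^ a * B :=
  abs_conc_le hf hμ hB κ₀ a _

omit [DecidableEq d] in
/-- **`L^p` scaling of pulled-back profiles**: `∫_{𝕋^d} |conc ∘ L|^p = |κ₀|^p μ^{ap-m} ∫_{ℝ^m} |f₀|^p`
(`μ ≥ 1`, `p > 0`) — CL22 Thm. 4.3 (2) with `a = m/2 + (order)`, `m = d - 1`. [cite: CheskidovLuo2022, Thm. 4.3 (2)] -/
theorem integral_abs_pull_conc_rpow (hf : IsProfile f₀) (hμ : 1 ≤ μ) (κ₀ a : ℝ) {p : ℝ} (hp : 0 < p) :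
    ∫ y, |T.pull (conc κ₀ a μ f₀) y| ^ p = |κ₀| ^ p * μ ^ (a * p - Fintype.card m) * ∫ z, |f₀ z| ^ p := by
  rw [← integral_abs_conc_rpow hf hμ κ₀ a hp]
  exact T.integral_pull (fun z => |conc κ₀ a μ f₀ z| ^ p)
    (((isSmooth_conc hf hμ κ₀ a).continuous.abs.rpow_const fun _ => Or.inr hp.le).aestronglyMeasurable)

omit [DecidableEq d] in
/-- `∫_{𝕋^d} (conc ∘ L)² = κ₀² μ^{2a-m} ∫ f₀²`. [folklore] -/
theorem integral_pull_conc_sq (hf : IsProfile f₀) (hμ : 1 ≤ μ) (κ₀ a : ℝ) :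
    ∫ y, T.pull (conc κ₀ a μ f₀) y ^ 2 = κ₀ ^ 2 * μ ^ (2 * a - Fintype.card m) * ∫ z, f₀ z * f₀ z := by
  rw [← integral_conc_sq hf hμ κ₀ a]
  exact T.integral_pull (fun z => conc κ₀ a μ f₀ z ^ 2) (((isSmooth_conc hf hμ κ₀ a).continuous.pow 2).aestronglyMeasurable)

omit [DecidableEq d] in
/-- `∫_{𝕋^d} conc ∘ L = κ₀ μ^{a-m} ∫ f₀`. [folklore] -/
theorem integral_pull_conc (hf : IsProfile f₀) (hμ : 1 ≤ μ) (κ₀ a : ℝ) :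
    ∫ y, T.pull (conc κ₀ a μ f₀) y = κ₀ * μ ^ (a - Fintype.card m) * ∫ z, f₀ z := by
  rw [← integral_conc hf hμ κ₀ a]
  exact T.integral_pull (conc κ₀ a μ f₀) (isSmooth_conc hf hμ κ₀ a).continuous.aestronglyMeasurable

end PullConc

/-! ## The Mikado profiles `ψ_x`, `φ_x`, `Θ_x` on `𝕋^d` -/

/-- **The pipe profile `ψ_x` of direction `k_x`** (CL22 (4.5): `ψ_k = μ^{(d-1)/2} ψ(μ dist(l_k, x))`;
here the pull-back of the periodic transverse profile `Ψ`). [cite: CheskidovLuo2022, §4.1 (4.5)] -/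
def psi (x : Index d) (μ : ℝ) : UnitAddTorus d → ℝ := (datum x).pull (psiT (datum x).c μ)

/-- **The potential `φ_x`**, `Δφ_x = ψ_x` (CL22 (4.6)–(4.7)). [cite: CheskidovLuo2022, §4.1 (4.6)–(4.7)] -/
def phi (x : Index d) (μ : ℝ) : UnitAddTorus d → ℝ := (datum x).pull (phiT (datum x).c μ)

/-- **The second potential `Θ_x`**, `ΔΘ_x = φ_x` (needed for two antidivergence layers). [folklore] -/
def theta (x : Index d) (μ : ℝ) : UnitAddTorus d → ℝ := (datum x).pull (thetaT (datum x).c μ)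

/-- The direction vector `k_x ∈ ℝ^d`. [folklore] -/
def dirVec (x : Index d) : EuclideanSpace ℝ d := WithLp.toLp 2 fun l => (dir x l : ℝ)

variable {x : Index d} {μ : ℝ}

/-- `ψ_x` is smooth (`μ ≥ 1`). [folklore] -/
theorem isSmooth_psi (x : Index d) (hμ : 1 ≤ μ) : IsSmooth (psi x μ) := (datum x).isSmooth_pull (isSmooth_psiT _ hμ)
/-- `φ_x` is smooth (`μ ≥ 1`). [folklore] -/
theorem isSmooth_phi (x : Index d) (hμ : 1 ≤ μ) : IsSmooth (phi x μ) := (datum x).isSmooth_pull (isSmooth_phiT _ hμ)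
/-- `Θ_x` is smooth (`μ ≥ 1`). [folklore] -/
theorem isSmooth_theta (x : Index d) (hμ : 1 ≤ μ) : IsSmooth (theta x μ) := (datum x).isSmooth_pull (isSmooth_thetaT _ hμ)

/-- The transverse weighted Laplacian is the `•`-form used by `laplacian_pull`. [folklore] -/
theorem torusWLap_eq {m : Type*} [Fintype m] [DecidableEq m] (c : m → ℝ) (P : UnitAddTorus m → ℝ) (z : UnitAddTorus m) :
    ∑ l', c l' • partialDeriv l' (partialDeriv l' P) z = torusWLap c P z := by
  simp [torusWLap]

/-- **`Δφ_x = ψ_x`** (CL22 (4.7)). [cite: CheskidovLuo2022, §4.1 (4.7)] -/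
theorem laplacian_phi (x : Index d) (hμ : 1 ≤ μ) : laplacian (phi x μ) = psi x μ := by
  funext y
  rw [phi, (datum x).laplacian_pull (isSmooth_phiT _ hμ), torusWLap_eq, torusWLap_phiT _ hμ]
  rfl

/-- **`ΔΘ_x = φ_x`**. [folklore] -/
theorem laplacian_theta (x : Index d) (hμ : 1 ≤ μ) : laplacian (theta x μ) = phi x μ := by
  funext y
  rw [theta, (datum x).laplacian_pull (isSmooth_thetaT _ hμ), torusWLap_eq, torusWLap_thetaT _ hμ]
  rfl

/-- **Invariance along the pipe**: `Dψ_x(y) k_x = 0` (so `(k·∇)ψ = 0`, `div W = 0`, `div(W ⊗ W) = 0`).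
[cite: CheskidovLuo2022, Thm. 4.3 (1)] -/
theorem fderiv_psi_dirVec (x : Index d) (hμ : 1 ≤ μ) (y : UnitAddTorus d) :
    Torus.fderiv (psi x μ) y (dirVec x) = 0 := by
  have h := (datum x).fderiv_pull_dir ((isSmooth_psiT (datum x).c hμ).isContDiff (by simp)) y
  rwa [datum_k] at h

/-- `Dφ_x(y) k_x = 0`. [folklore] -/
theorem fderiv_phi_dirVec (x : Index d) (hμ : 1 ≤ μ) (y : UnitAddTorus d) :
    Torus.fderiv (phi x μ) y (dirVec x) = 0 := by
  have h := (datum x).fderiv_pull_dir ((isSmooth_phiT (datum x).c hμ).isContDiff (by simp)) y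
  rwa [datum_k] at h

/-- `DΘ_x(y) k_x = 0`. [folklore] -/
theorem fderiv_theta_dirVec (x : Index d) (hμ : 1 ≤ μ) (y : UnitAddTorus d) :
    Torus.fderiv (theta x μ) y (dirVec x) = 0 := by
  have h := (datum x).fderiv_pull_dir ((isSmooth_thetaT (datum x).c hμ).isContDiff (by simp)) y
  rwa [datum_k] at h

/-- **Unit energy**: `∫_{𝕋^d} ψ_x² = 1` (`d ≥ 2`, `μ ≥ 1`; CL22 (4.7)). [cite: CheskidovLuo2022, §4.1 (4.7)] -/
theorem integral_psi_sq (hd : 2 ≤ Fintype.card d) (x : Index d) (hμ : 1 ≤ μ) : ∫ y, psi x μ y ^ 2 = 1 := by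
  haveI := nonempty_slot hd x
  calc ∫ y, psi x μ y ^ 2 = ∫ z, psiT (datum x).c μ z ^ 2 :=
        (datum x).integral_pull (fun z => psiT (datum x).c μ z ^ 2)
          (((isSmooth_psiT _ hμ).continuous.pow 2).aestronglyMeasurable)
    _ = 1 := integral_psiT_sq (datum_c_pos x) hμ

/-- `∫_{𝕋^d} ψ_x = 0` (zero mean). [folklore] -/
theorem integral_psi (x : Index d) (hμ : 1 ≤ μ) : ∫ y, psi x μ y = 0 := by
  rw [← integral_psiT (datum x).c hμ]
  exact (datum x).integral_pull _ (isSmooth_psiT _ hμ).continuous.aestronglyMeasurable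

/-- `∫_{𝕋^d} φ_x = 0` (zero mean). [folklore] -/
theorem integral_phi (x : Index d) (hμ : 1 ≤ μ) : ∫ y, phi x μ y = 0 := by
  rw [← integral_phiT (datum x).c hμ]
  exact (datum x).integral_pull _ (isSmooth_phiT _ hμ).continuous.aestronglyMeasurable

end Mikado
end Literature.Analysis.FluidPDE
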